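import Mathlib
import HarnessLib
import Summits.HubbardSuperconductivity.HubbardSuperconductivity.Theses.AposterioriCapRg
import Literature.Barriers.HubbardSuperconductivity.WeakCouplingCeiling
import Literature.MathematicalPhysics.QuantumLattice.HubbardFermiRadius

/-!
# Sketch — first lemmas of three crux ideas for `SeededBrokenRegimeBoseFermiPinned`
(stmt-HubbardSuperconductivity-14047; crux-ideate round 1, ideator 2).

Nothing here is a route item.  Each `FL*` is the FIRST CHECKABLE STATEMENT of a line, typed over
existing declarations so that it elaborates; `seedTransfer` is additionally PROVED (pure logic) because
it is the typed shape of idea 2's transfer `C⁺ → crux-conclusion`.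

* idea 1 `mu-broken-frame-certified-sectors` — `FL1_RhombusRule` (FMRT 1992 Lemma 3 /
  Magnen–Unterberger 2019 Prop. 2.5(i) for the renormalised band of a certified frame).
* idea 2 `seed-pins-only-the-rotor` — `FL2_GoldstoneKernelLocallyIntegrable` (dimension count) and
  the transfer `limitReportCT` / `seedTransfer` (h-uniformity = one limit tuple in the interior of `D`).
* idea 3 `channel-margin-arithmetic` — `FL3_SubdominantStaysWeak` (+ proof) and
  `FL3_poleScaleSeparation`.
-/

namespace Summit.HubbardSuperconductivity.HubbardSuperconductivity.Cruxes.SeededBrokenRegimeBoseFermiPinned.Sketch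

open scoped BigOperators Topology
open Filter Set MeasureTheory
open Literature.MathematicalPhysics.QuantumLattice
open Literature.Barriers.HubbardSuperconductivity (cooperLadder)

/-! ### Idea 1 — the rhombus rule (sector counting) for a certified frame -/

/-- Distance on the Brillouin torus `ℝ²/2πℤ²` between two continuum momenta (componentwise nearest
representative, sup norm). -/
noncomputable def torusDist (p q : Fin 2 → ℝ) : ℝ :=
  max (|toIocMod Real.two_pi_pos (-Real.pi) (p 0 - q 0)|) (|toIocMod Real.two_pi_pos (-Real.pi) (p 1 - q 1)|)

/-- `RhombusRule e Λ C`: FMRT's "vector-model" geometry of a band `e` below scale `Λ` — four momenta in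
the `Λ'`-shell of `{e = 0}` (`Λ' ≤ Λ`) whose sum is conserved up to `Λ'` modulo the reciprocal lattice are
either a COOPER configuration (`p₁ ≈ -p₂`) or a FORWARD/EXCHANGE one (`p₁ ≈ p₃` or `p₁ ≈ p₄`), to within
`C √Λ'` — the only index structures of an `N(Λ')`-vector model, `N(Λ') ≍ Λ'^{-1/2}`
(Magnen–Unterberger 2019 Prop. 2.5(i): `|α|·|θ| ≲ 2^{-j}`). -/
def RhombusRule (e : (Fin 2 → ℝ) → ℝ) (Λ C : ℝ) : Prop :=
  ∀ Λ' ∈ Set.Ioc (0:ℝ) Λ, ∀ p : Fin 4 → (Fin 2 → ℝ),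
    (∀ i, (∀ j, |p i j| ≤ Real.pi) ∧ |e (p i)| ≤ Λ') →
    (∃ G : Fin 2 → ℤ, ∀ j, |p 0 j + p 1 j - p 2 j - p 3 j - 2 * Real.pi * G j| ≤ Λ') →
    min (torusDist (p 0 + p 1) 0) (min (torusDist (p 0) (p 2)) (torusDist (p 0) (p 3))) ≤ C * Real.sqrt Λ'

/-- **FL1 (idea 1).** For the renormalised band `e_K = renormalisedBandC μ K` of ANY frame whose
`Λ`-shell satisfies the certificate's geometry clause (0d) (`ShellGeometry … v₁ v₂ κ₁ κ₂ d` with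
`κ₁ > 0`, `v₁ > 0`) and whose zero set in the square is ONE polar loop around `Γ`, the rhombus rule holds
with a constant depending only on `(v₁, v₂, κ₁, κ₂)` — hence uniformly over the certified family, which
is what makes the sector number `N(Λ') ≥ c(π₀) Λ'^{-1/2}` a CERTIFIED expansion parameter below `Λ*`.
(Core at band-bottom fillings already in the tree: `chordSum_rigidity_fst/snd`,
`HubbardFermiChordRigidity.lean`.) -/
def FL1_RhombusRule : Prop :=
  ∀ v₁ v₂ κ₁ κ₂ d : ℝ, 0 < v₁ → 0 < κ₁ → ∃ C : ℝ, 0 < C ∧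
    ∀ (μ : ℝ) (K : TrigPolyC4v) (Λ : ℝ), 0 < Λ →
      ShellGeometry (renormalisedBandC μ K) Λ v₁ v₂ κ₁ κ₂ d →
      (∃ u : ℝ → ℝ, Continuous u ∧ (∀ θ, 0 < u θ) ∧ (∀ θ, u (θ + 2 * Real.pi) = u θ) ∧
        ∀ p : Fin 2 → ℝ, (∀ j, |p j| ≤ Real.pi) →
          (renormalisedBandC μ K p = 0 ↔ ∃ θ : ℝ, p = u θ • dir θ)) →
      RhombusRule (renormalisedBandC μ K) Λ C

/-! ### Idea 2 — the seed pins only the rotor -/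

/-- **FL2 (idea 2), dimension count.** The Goldstone exchange kernel `1/(κ ν² + D_s q⃗² + m)` is
LOCALLY INTEGRABLE in `2+1` momentum dimensions UNIFORMLY in the mass `m ≥ 0` (here `m = h·m₀`): its
integral over a ball of radius `Λ` is `≤ C(κ, D_s) Λ`.  This is what makes every non-zero-mode Goldstone
insertion `h`-uniformly bounded in the report's momentum-space `legKernelNorm`, and what FAILS in `2+0`
dimensions (fixed `β`: Hohenberg–Mermin–Wagner). -/
def FL2_GoldstoneKernelLocallyIntegrable : Prop :=
  ∀ κ D : ℝ, 0 < κ → 0 < D → ∃ C : ℝ, ∀ m : ℝ, 0 ≤ m → ∀ Λ : ℝ, 0 < Λ →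
    ∫ x in Metric.closedBall (0 : EuclideanSpace ℝ (Fin 3)) Λ,
        (κ * (x 0) ^ 2 + D * ((x 1) ^ 2 + (x 2) ^ 2) + m)⁻¹ ≤ C * Λ

/-- `D` encloses `p` with margin `δ`: every tuple `δ`-close to `p` is still enclosed (interior point of
the certificate box). -/
def EnclosesWithMargin (D : HubbardScaleData) (p : HubbardScaleData.Parameters D.numPatches) (δ : ℝ) : Prop :=
  ∀ p' : HubbardScaleData.Parameters D.numPatches, p.IsClose p' δ → D.Encloses p'

/-- **The `h → 0⁺` limit report** of the countertermed seeded torus (idea 2's transfer object): the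
tuples `p` approached by realised tuples along `h → 0⁺`, THEN `L ≥ L₀(h)`, THEN `β ≥ β₀(L, h)` — exactly
the quantifier order of the crux (`∀ h ∃ L₀'`) composed with `IsCertifiedEnclosure` (`∀ L ∃ β₀ ∀ β`).
Idea 2 says: this set is non-empty and is computed by the `h = 0` PINNED-ROTOR theory, with
`L₀(h) ≍ (h m₀ κ)^{-1/4}`. -/
def limitReportCT (U μ : ℝ) (D : HubbardScaleData) : Set (HubbardScaleData.Parameters D.numPatches) :=
  {p | ∀ δ : ℝ, 0 < δ → ∃ h₀ : ℝ, 0 < h₀ ∧ ∀ h ∈ Set.Ioc (0:ℝ) h₀, ∃ L₀ : ℕ, ∀ L : ℕ, L₀ ≤ L →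
    ∃ β₀ : ℝ, ∀ β : ℝ, β₀ ≤ β → ∃ p' ∈ hubbardScaleReportCT U μ D h L β, p.IsClose p' δ}

/-- **Transfer (idea 2), PROVED**: one limit tuple in the interior of the certificate box gives the
crux's conclusion tail `∃ h₀ > 0, ∀ h ∈ (0,h₀], ∃ L₀', D.IsCertifiedEnclosure (hubbardScaleReportCT U μ D h) L₀'`
by pure logic.  So `h`-UNIFORMITY of [3] reduces to: (a) existence of the `h → 0⁺` limit of the realised
parameters in the crux's order of limits (the zero-mode / pinning lemma), (b) choosing `D` around it with
margin (free: `D` is chosen after the point). -/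
theorem seedTransfer (U μ : ℝ) (D : HubbardScaleData)
    (hlim : ∃ p ∈ limitReportCT U μ D, ∃ δ : ℝ, 0 < δ ∧ EnclosesWithMargin D p δ) :
    ∃ h₀ : ℝ, 0 < h₀ ∧ ∀ h ∈ Set.Ioc (0:ℝ) h₀, ∃ L₀' : ℕ,
      D.IsCertifiedEnclosure (hubbardScaleReportCT U μ D h) L₀' := by
  obtain ⟨p, hp, δ, hδ, hmargin⟩ := hlim
  obtain ⟨h₀, hh₀, H⟩ := hp δ hδ
  refine ⟨h₀, hh₀, fun h hh => ?_⟩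
  obtain ⟨L₀, HL⟩ := H h hh
  refine ⟨L₀, fun L hL => ?_⟩
  obtain ⟨β₀, Hβ⟩ := HL L hL
  refine ⟨β₀, fun β hβ => ?_⟩
  obtain ⟨p', hp', hclose⟩ := Hβ β hβ
  exact ⟨p', hp', hmargin p' hclose⟩

/-- **FL2′ (idea 2), the typed target of the zero-mode lemma**: under the v3 certificate at the pinned
literal, the limit report is inhabited by a tuple meeting the thresholds' sign/size pattern, enclosable
with margin.  (Informal content: the pinned-rotor `h = 0` theory realises `p⋆`; realised tuples at
`(h, L ≥ L₀(h), β ≥ β₀)` converge to `p⋆`.)  Combined with `seedTransfer` and a choice of rational box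
`D ∋ p⋆` this is the crux's conclusion. -/
def FL2_LimitTupleExists : Prop :=
  ∀ kStar etaStar : ℚ, 0 < kStar → 0 < etaStar → ∃ Θ : SymmetricTolerance,
    ∀ U ∈ Set.Icc (2:ℝ) 3, ∀ μ : ℝ, ∀ (K : TrigPolyC4v) (Λ : ℝ) (L₀ : ℕ),
      symmetricRegimeCertificateT U μ capRgCornerDataT Θ K Λ L₀ →
      ∃ D : HubbardScaleData, D.MeetsThresholds kStar etaStar ∧ 0 < D.numPatches ∧
        0 < D.meanFieldDensity.fst ∧
        ∃ p ∈ limitReportCT U μ D, ∃ δ : ℝ, 0 < δ ∧ EnclosesWithMargin D p δ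

/-! ### Idea 3 — channel margin arithmetic below `Λ*` -/

/-- **FL3 (idea 3), subdominant channels stay weak up to the B1g pole.** With the certified Cooper
spectrum at `Λ*` — bottom `λ₁ = -λ_d < 0`, every other eigenvalue `λ₂ ≥ λ₁/2` (margin `2`, clause (ii′)) —
the `N = ∞` (ladder) flow `λ ↦ λ/(1 + λ b)` (`cooperLadder 1 λ b`, `b ≥ 0` the Cooper bubble accumulated
between `Λ*` and `Λ`) keeps every ATTRACTIVE subdominant channel at modulus `≤ |λ₁| = λ_d(Λ*) ≤ 1/5` for
all `b` up to the B1g pole `b = 1/λ_d`: only ONE channel condenses, with the others still perturbative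
when the gap forms. -/
def FL3_SubdominantStaysWeak : Prop :=
  ∀ l₁ l₂ b : ℝ, l₁ < 0 → l₁ / 2 ≤ l₂ → l₂ ≤ 0 → 0 ≤ b → b ≤ -1 / l₁ →
    |cooperLadder 1 l₂ b| ≤ |l₁|

/-- Proof of `FL3_SubdominantStaysWeak` (elementary). -/
theorem fl3_subdominantStaysWeak : FL3_SubdominantStaysWeak := by
  intro l₁ l₂ b h1 h12 h2 hb hb1
  have hden : (1:ℝ) / 2 ≤ 1 + 1 * l₂ * b := by
    have hbl : l₂ * b ≥ (l₁ / 2) * b := mul_le_mul_of_nonneg_right h12 hb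
    have : (l₁ / 2) * b ≥ (l₁ / 2) * (-1 / l₁) := by
      apply mul_le_mul_of_nonpos_left hb1
      linarith
    have hl1 : l₁ ≠ 0 := ne_of_lt h1
    have hcalc : (l₁ / 2) * (-1 / l₁) = -1 / 2 := by
      field_simp
    nlinarith
  have hdenpos : 0 < 1 + 1 * l₂ * b := by linarith
  unfold cooperLadder
  rw [abs_div, abs_of_pos hdenpos, div_le_iff₀ hdenpos, abs_of_nonpos h2, abs_of_neg h1]
  nlinarith

/-- **FL3, pole-scale separation** (arithmetic of the margin): a subdominant attractive channel of
strength `λ₂' ≤ λ_d/2` would reach its own ladder pole only at `Λ* e^{-1/λ₂'} ≤ Λ* (e^{-1/λ_d})² =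
Λ_c · (Λ_c/Λ*) ≤ e^{-5} Λ_c` inside the window — parametrically below the scale where the B1g gap has
formed and cut its bubble off. -/
theorem FL3_poleScaleSeparation (ld l₂ : ℝ) (hld : 0 < ld) (hl₂ : 0 < l₂) (hmargin : l₂ ≤ ld / 2) :
    Real.exp (-1 / l₂) ≤ Real.exp (-1 / ld) ^ 2 := by
  rw [← Real.exp_nat_mul]
  apply Real.exp_le_exp.mpr
  have h2 : (1:ℝ) / l₂ ≥ 2 / ld := by
    rw [ge_iff_le, div_le_div_iff₀ hld hl₂]
    linarith
  have : -1 / l₂ = -(1 / l₂) := by ring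
  have : ((2:ℕ):ℝ) * (-1 / ld) = -(2 / ld) := by push_cast; ring
  linarith

end Summit.HubbardSuperconductivity.HubbardSuperconductivity.Cruxes.SeededBrokenRegimeBoseFermiPinned.Sketch
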